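import Literature.NumberTheory.LFunctions.PowerOscillatoryIntegrals
import HarnessLib

/-!
# The zeta-regularized absolute zeta function of Kurokawa–Ochiai: `Z_N(w;s)` and
# `ζ_N(s) = exp(∂_w Z_N(w;s)|_{w=0}) = ∏_α (s−α)^{−m(α)}` for a finite sum `N(u) = Σ_α m(α)u^α`
# (Kurokawa–Ochiai 2013, Theorems A and B; Kurokawa–Tanaka 2017, §1)

Topic `Literature/NumberTheory/F1Geometry` (namespace `Literature.NumberTheory.F1Geometry`, grouping
sub-namespace `AbsoluteZeta` = the object).  Everything in this file is a definition with a body or a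
theorem: NO named facts, no `sorry` (D-0014/D-0026).

Sources, read at the page.  [KurokawaOchiai2013] N. Kurokawa, H. Ochiai, *Dualities for absolute zeta
functions and multiple gamma functions*, Proc. Japan Acad. 89A (2013) 75–79 = arXiv:1304.2472 (held:
`paper:arxiv-1304.2472`, §1 and §3–§4).  [KurokawaTanaka2017] N. Kurokawa, H. Tanaka, *Absolute zeta
functions and the automorphy*, Kodai Math. J. 40 (2017) 584–614, §1 "General constructions"
pp. 591–592 (J-STAGE open PDF, text deposited by the census reader seat t5-r3).

## What is printed

[KurokawaOchiai2013, §1 p. 75]: the absolute zeta function of Soulé / Connes–Consani is the integral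
"`ζ_X(s) = exp(∫_1^∞ N_X(u) u^{-s-1} (log u)^{-1} du)`" which diverges at `u = 1`; "Our purpose is to
introduce the absolute Hurwitz zeta function `Z_X(w;s) = Γ(w)^{-1} ∫_1^∞ N_X(u) u^{-s-1} (log u)^{w-1} du`
to get the canonical normalization `ζ_X(s) = exp(∂_w Z_X(w;s)|_{w=0})`.  This normalization is
essentially due to Riemann (1859)".  "For a function `N : (1,∞) → ℂ` we use
`Z_N(w;s) = Γ(w)^{-1} ∫_1^∞ N(u) u^{-s-1}(log u)^{w-1} du` and `ζ_N(s) = exp(∂_w Z_N(w;s)|_{w=0})` also."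
**Theorem A.** "Let `N(u) = Σ_α m(α) u^α` be a finite sum. Then: (1) `Z_N(w;s) = Σ_α m(α)(s−α)^{−w}`.
(2) `ζ_N(s) = ∏_α (s−α)^{−m(α)}`."  Examples 1–2: `ζ_{Spec 𝔽₁}(s) = 1/s` (`N = 1`),
`ζ_{SL(2)}(s) = (s−1)/(s−3)` (`N(u) = u³ − u`).  **Lemma** (§3, the proof of Theorem A, "It is sufficient
to calculate the following monomial case"): `N(u) = u^α ⟹ Z_N(w;s) = (s−α)^{−w}`, by
"`Γ(w)^{-1}∫_1^∞ u^{α−s−1}(log u)^{w−1} du = Γ(w)^{-1}∫_0^∞ e^{−(s−α)t} t^{w−1} dt = (s−α)^{−w}`. Hence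
`∂_w Z_N(w,s)|_{w=0} = −log(s−α)` and `ζ_N(s) = 1/(s−α)`."  **Theorem B.** "(1) `(N₁⊕N₂)(u) = N₁(u)+N₂(u)`.
Then `Z_{N₁⊕N₂}(w;s) = Z_{N₁}(w;s) + Z_{N₂}(w;s)` and `ζ_{N₁⊕N₂}(s) = ζ_{N₁}(s)ζ_{N₂}(s)`.  (2) …
`(N₁⊗N₂)(u) = N₁(u)N₂(u)`. Then `Z_{N₁⊗N₂}(w;s) = Σ_{α₁,α₂} m₁(α₁)m₂(α₂)(s−(α₁+α₂))^{−w}` and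
`ζ_{N₁⊗N₂}(s) = ∏_{α₁,α₂}(s−(α₁+α₂))^{−m₁(α₁)m₂(α₂)}`.  This tensor product is essentially the Kurokawa
tensor product".  [KurokawaTanaka2017, §1 p. 591]: "`Z_f(w,s) = Γ(w)^{-1}∫_1^∞ f(x) x^{-s}(log x)^{w-1} dx/x`
and `ζ_f(s) = exp(∂_w Z_f(w,s)|_{w=0})`, where we assume that `Z_f(w,s)` has an analytic continuation
in `w` to a region containing `w = 0`. … For example, let `f(x) = x^a` (`a ∈ ℂ`). Then
`Z_f(w,s) = (s−a)^{−w}`, `ζ_f(s) = 1/(s−a)`".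

## What this file proves (all `theorem`s)

* `absoluteHurwitzZeta N w s` is the printed `Z_N(w;s)` (Bochner integral over `(1,∞)`, principal
  powers); a finite sum is a finitely supported multiplicity function `m : ℂ →₀ ℤ` (exponents
  `α ∈ ℂ`, as in [KurokawaTanaka2017, §1] "`a ∈ ℂ`"), `countFun m u = Σ_α m(α) u^α`.
* **Theorem A (1)** `absoluteHurwitzZeta_countFun`: for `Re w > 0` and `Re s > Re α` on the support
  (where the integral converges), `Z_N(w;s) = hurwitzSum m w s = Σ_α m(α)(s−α)^{−w}` — by the printed
  substitution `u = e^t` (`integral_Ioi_one_eq_integral_exp`) and the Gamma integral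
  `∫_0^∞ t^{w−1}e^{−rt}dt = Γ(w) r^{−w}` for COMPLEX `r`, `Re r > 0` (the tree's
  `Literature.NumberTheory.LFunctions.AFE.integral_cpow_mul_exp_neg_mul_Ioi_complex`); the monomial
  **Lemma** is `absoluteHurwitzZeta_single`.
* the analytic continuation in `w` used in print: `hurwitzSum m · s` is entire
  (`analyticOnNhd_hurwitzSum`), and ANY analytic continuation of `Z_N(·;s)` from the half-plane
  `Re w > 0` to a connected open set agrees with it (`eqOn_hurwitzSum_of_continuation`), so
  `ζ_N(s) := exp(∂_w Z_N(w;s)|_{w=0})` is well defined: `zetaReg m s := exp (deriv (hurwitzSum m · s) 0)`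
  and `exp_deriv_eq_zetaReg_of_continuation`.
* **Theorem A (2)** `zetaReg_eq_zetaProd`: `ζ_N(s) = zetaProd m s = ∏_α (s−α)^{−m(α)}` (integer powers)
  for `s` off the exponents; `zetaProd` is the rational/meromorphic continuation in `s`.
* **Theorem B (1)** `absoluteHurwitzZeta_add`, `hurwitzSum_add`, `zetaReg_add`; **Theorem B (2)**
  (Kurokawa tensor product) `countFun_tensor`, `hurwitzSum_tensor`, `zetaReg_tensor`.
* Examples 1–2: `hurwitzSum_specF1`, `zetaReg_specF1`, `countFun_multSL2`, `hurwitzSum_multSL2`,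
  `zetaReg_multSL2`.

Not covered here: the functional equation / ε-factor under the automorphy `f(1/x) = C x^{−D} f(x)`
and the virtual representations of [KurokawaTanaka2017, Thms 1–2] (a natural sequel on top of
`zetaProd`); the multiple gamma / sine functions of negative order [KurokawaOchiai2013, Thms 1–4, C].
Relation to the barrier entry `Literature.Barriers.RiemannHypothesis.AbsoluteZetaPolynomialCounting`
(Soulé's `q → 1` LIMIT definition for a counting POLYNOMIAL): for `N ∈ ℤ[x]` both give
`∏_k (s−k)^{−a_k}`; this file is the zeta-REGULARIZED definition of [KurokawaOchiai2013] for arbitrary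
finite sums with complex exponents (e.g. `N(u) = u^{1/2}`, or the purely imaginary exponents of unitary
characters in [KurokawaTanaka2017, Thm 2]).
-/

noncomputable section

open Complex MeasureTheory Set Filter Finset
open scoped Real Topology

namespace Literature.NumberTheory.F1Geometry

namespace AbsoluteZeta

/-! ## §1. The objects -/

/-- The absolute Hurwitz zeta function of a function `N : (1,∞) → ℂ`:
`Z_N(w;s) = Γ(w)⁻¹ ∫_1^∞ N(u) u^{-s-1} (log u)^{w-1} du` (principal powers; the integral converges for
`Re w > 0` and `N(u) = O(u^{Re s − ε})`). [cite: KurokawaOchiai2013, §1 p. 75 and §3] -/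
def absoluteHurwitzZeta (N : ℝ → ℂ) (w s : ℂ) : ℂ :=
  (Gamma w)⁻¹ *
    ∫ u in Ioi (1 : ℝ), N u * (u : ℂ) ^ (-s - 1) * ((Real.log u : ℝ) : ℂ) ^ (w - 1)

/-- A finite sum `N(u) = Σ_α m(α) u^α` (`α ∈ ℂ`, integer multiplicities `m(α)`), encoded by its
finitely supported multiplicity function `m`, evaluated at `u > 0` with principal powers.
[cite: KurokawaOchiai2013, Thm A] -/
def countFun (m : ℂ →₀ ℤ) (u : ℝ) : ℂ :=
  m.sum fun α k => (k : ℂ) * (u : ℂ) ^ α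

/-- The closed form `Σ_α m(α) (s − α)^{−w}` of `Z_N(w;s)` for a finite sum (entire in `w`; it is the
analytic continuation in `w` used to define `ζ_N`). [cite: KurokawaOchiai2013, Thm A (1)] -/
def hurwitzSum (m : ℂ →₀ ℤ) (w s : ℂ) : ℂ :=
  m.sum fun α k => (k : ℂ) * (s - α) ^ (-w)

/-- The zeta-regularized absolute zeta function `ζ_N(s) = exp(∂_w Z_N(w;s)|_{w=0})` of a finite sum,
the `w`-derivative being taken on the analytic continuation `hurwitzSum` (justified by
`eqOn_hurwitzSum_of_continuation`). [cite: KurokawaOchiai2013, §1 p. 75] [cite: KurokawaTanaka2017, §1 p. 591] -/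
def zetaReg (m : ℂ →₀ ℤ) (s : ℂ) : ℂ :=
  Complex.exp (deriv (fun w => hurwitzSum m w s) 0)

/-- The product `∏_α (s − α)^{−m(α)}` (integer powers; a pole `s = α`, `m(α) > 0` takes Lean's junk
value `0⁻¹ = 0`). [cite: KurokawaOchiai2013, Thm A (2)] -/
def zetaProd (m : ℂ →₀ ℤ) (s : ℂ) : ℂ :=
  m.prod fun α k => (s - α) ^ (-k)

/-- The half-plane of convergence `Re s > Re α` for every exponent `α` of the finite sum (where
`∫_0^∞ e^{−(s−α)t} t^{w−1} dt` converges). [cite: KurokawaOchiai2013, §3 (proof of the Lemma)] -/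
def ReGt (m : ℂ →₀ ℤ) (s : ℂ) : Prop :=
  ∀ α ∈ m.support, α.re < s.re

/-- On the half-plane of convergence `s` is none of the exponents, so every `s − α ≠ 0`.
[cite: KurokawaOchiai2013, §3 (proof of the Lemma)] -/
theorem ne_of_reGt {m : ℂ →₀ ℤ} {s : ℂ} (hs : ReGt m s) : ∀ α ∈ m.support, s ≠ α := by
  intro α hα h
  have := hs α hα
  rw [h] at this
  exact lt_irrefl _ this

/-! ## §2. The monomial lemma: `Γ(w)⁻¹ ∫_1^∞ u^{α-s-1}(log u)^{w-1} du = (s-α)^{-w}` -/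

/-- `arg r ≠ π` on the open right half-plane. [folklore] -/
private theorem arg_ne_pi_of_re_pos {r : ℂ} (hr : 0 < r.re) : r.arg ≠ π := fun h =>
  lt_irrefl _ ((arg_eq_pi_iff.1 h).1.trans hr)

/-- `∫_0^∞ t^{w-1} e^{-rt} dt = Γ(w) r^{-w}` for `Re w > 0`, `Re r > 0` (principal power).
[cite: KurokawaOchiai2013, §3 (proof of the Lemma)] -/
theorem integral_cpow_mul_exp {w r : ℂ} (hw : 0 < w.re) (hr : 0 < r.re) :
    ∫ t in Ioi (0 : ℝ), (t : ℂ) ^ (w - 1) * Complex.exp (-(r * t)) = Gamma w * r ^ (-w) := by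
  rw [Literature.NumberTheory.LFunctions.AFE.integral_cpow_mul_exp_neg_mul_Ioi_complex hw hr, one_div,
    inv_cpow _ _ (arg_ne_pi_of_re_pos hr), cpow_neg, mul_comm]

/-- Integrability of `t^{w-1} e^{-rt}` on `(0,∞)` (`Re w > 0`, `Re r > 0`): its integral is the
non-zero number `Γ(w) r^{-w}` (convergence of the printed `∫_0^∞ e^{−(s−α)t} t^{w−1} dt`).
[cite: KurokawaOchiai2013, §3 (proof of the Lemma)] -/
theorem integrableOn_cpow_mul_exp {w r : ℂ} (hw : 0 < w.re) (hr : 0 < r.re) :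
    IntegrableOn (fun t : ℝ => (t : ℂ) ^ (w - 1) * Complex.exp (-(r * t))) (Ioi 0) := by
  by_contra h
  have h0 : ∫ t in Ioi (0 : ℝ), (t : ℂ) ^ (w - 1) * Complex.exp (-(r * t)) = 0 := integral_undef h
  rw [integral_cpow_mul_exp hw hr] at h0
  have hr0 : r ≠ 0 := by
    rintro rfl
    simp at hr
  exact mul_ne_zero (Gamma_ne_zero_of_re_pos hw) (cpow_ne_zero_iff.2 (Or.inl hr0)) h0

/-- The substitution `u = e^t`: `∫_1^∞ g(u) du = ∫_0^∞ e^t g(e^t) dt` (the second equality of the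
printed proof of the Lemma; "`Z(w,s) = Γ(w)^{-1}∫_0^∞ f(e^t)e^{−st}t^{w−1}dt` is the Mellin transform").
[cite: KurokawaOchiai2013, §3 (proof of the Lemma)] [cite: KurokawaTanaka2017, Introduction pp. 585–586] -/
theorem integral_Ioi_one_eq_integral_exp (g : ℝ → ℂ) :
    ∫ u in Ioi (1 : ℝ), g u = ∫ t in Ioi (0 : ℝ), (Real.exp t : ℂ) * g (Real.exp t) := by
  have h := integral_image_eq_integral_abs_deriv_smul (s := Ioi (0 : ℝ)) (f := Real.exp)
    (f' := Real.exp) measurableSet_Ioi (fun x _ => (Real.hasDerivAt_exp x).hasDerivWithinAt)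
    Real.exp_injective.injOn g
  rw [Real.image_exp_Ioi, Real.exp_zero] at h
  rw [h]
  refine setIntegral_congr_fun measurableSet_Ioi (fun t _ => ?_)
  simp only [abs_of_pos (Real.exp_pos t), Complex.real_smul]

/-- `(e^t)^z = e^{tz}` for real `t` (principal power of a positive real). [folklore] -/
private theorem ofReal_exp_cpow (t : ℝ) (z : ℂ) : ((Real.exp t : ℝ) : ℂ) ^ z = Complex.exp (t * z) := by
  rw [cpow_def_of_ne_zero (ofReal_ne_zero.2 (Real.exp_pos t).ne'), ← ofReal_log (Real.exp_pos t).le,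
    Real.log_exp]

/-- `N(e^t) = Σ_α m(α) e^{αt}`. [cite: KurokawaOchiai2013, §3] -/
theorem countFun_exp (m : ℂ →₀ ℤ) (t : ℝ) :
    countFun m (Real.exp t) = ∑ α ∈ m.support, (m α : ℂ) * Complex.exp (t * α) := by
  simp only [countFun, Finsupp.sum, ofReal_exp_cpow]

/-- After the substitution `u = e^t` the integrand of `Z_N(w;s)` is `Σ_α m(α) t^{w-1} e^{-(s-α)t}`.
[cite: KurokawaOchiai2013, §3] -/
theorem exp_mul_integrand (m : ℂ →₀ ℤ) (w s : ℂ) (t : ℝ) :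
    (Real.exp t : ℂ) * (countFun m (Real.exp t) * ((Real.exp t : ℝ) : ℂ) ^ (-s - 1) *
        ((Real.log (Real.exp t) : ℝ) : ℂ) ^ (w - 1)) =
      ∑ α ∈ m.support, (m α : ℂ) * ((t : ℂ) ^ (w - 1) * Complex.exp (-((s - α) * t))) := by
  rw [Real.log_exp, countFun_exp, ofReal_exp_cpow, Complex.ofReal_exp, Finset.sum_mul, Finset.sum_mul,
    Finset.mul_sum]
  refine Finset.sum_congr rfl fun α _ => ?_
  have h : Complex.exp ↑t * Complex.exp (↑t * α) * Complex.exp (↑t * (-s - 1)) =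
      Complex.exp (-((s - α) * ↑t)) := by
    rw [← Complex.exp_add, ← Complex.exp_add]
    congr 1
    ring
  calc Complex.exp ↑t * ((m α : ℂ) * Complex.exp (↑t * α) * Complex.exp (↑t * (-s - 1)) *
          (t : ℂ) ^ (w - 1))
        = (m α : ℂ) * ((t : ℂ) ^ (w - 1) *
            (Complex.exp ↑t * Complex.exp (↑t * α) * Complex.exp (↑t * (-s - 1)))) := by ring
    _ = (m α : ℂ) * ((t : ℂ) ^ (w - 1) * Complex.exp (-((s - α) * ↑t))) := by rw [h]

/-- **Theorem A (1)** [Kurokawa–Ochiai]: for a finite sum `N(u) = Σ_α m(α)u^α`,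
`Z_N(w;s) = Σ_α m(α)(s−α)^{−w}` on the domain of convergence `Re w > 0`, `Re s > Re α`.
[cite: KurokawaOchiai2013, Thm A (1) and §3] -/
theorem absoluteHurwitzZeta_countFun (m : ℂ →₀ ℤ) {w s : ℂ} (hw : 0 < w.re) (hs : ReGt m s) :
    absoluteHurwitzZeta (countFun m) w s = hurwitzSum m w s := by
  have hr : ∀ α ∈ m.support, 0 < (s - α).re := fun α hα => by
    rw [sub_re]; linarith [hs α hα]
  unfold absoluteHurwitzZeta
  rw [integral_Ioi_one_eq_integral_exp]
  have h1 : (∫ t in Ioi (0 : ℝ), (Real.exp t : ℂ) * (countFun m (Real.exp t) *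
      ((Real.exp t : ℝ) : ℂ) ^ (-s - 1) * ((Real.log (Real.exp t) : ℝ) : ℂ) ^ (w - 1))) =
      ∫ t in Ioi (0 : ℝ), ∑ α ∈ m.support,
        (m α : ℂ) * ((t : ℂ) ^ (w - 1) * Complex.exp (-((s - α) * t))) :=
    setIntegral_congr_fun measurableSet_Ioi fun t _ => exp_mul_integrand m w s t
  rw [h1, integral_finsetSum _ fun α hα =>
    (Integrable.const_mul (integrableOn_cpow_mul_exp hw (hr α hα)) _)]
  simp only [integral_const_mul]
  rw [hurwitzSum, Finsupp.sum, Finset.mul_sum]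
  refine Finset.sum_congr rfl fun α hα => ?_
  rw [integral_cpow_mul_exp hw (hr α hα), mul_left_comm (m α : ℂ), ← mul_assoc,
    inv_mul_cancel₀ (Gamma_ne_zero_of_re_pos hw), one_mul]

/-- `N(u) = k·u^α` for the multiplicity function `k·δ_α`. [cite: KurokawaOchiai2013, §3 Lemma] -/
theorem countFun_single (α : ℂ) (k : ℤ) (u : ℝ) :
    countFun (Finsupp.single α k) u = (k : ℂ) * (u : ℂ) ^ α := by
  simp [countFun, Finsupp.sum_single_index]

/-- `hurwitzSum` of `k·δ_α` is `k (s−α)^{−w}`. [cite: KurokawaOchiai2013, §3 Lemma] -/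
theorem hurwitzSum_single (α : ℂ) (k : ℤ) (w s : ℂ) :
    hurwitzSum (Finsupp.single α k) w s = (k : ℂ) * (s - α) ^ (-w) := by
  simp [hurwitzSum, Finsupp.sum_single_index]

/-- **Lemma** (monomial case) [Kurokawa–Ochiai]: `N(u) = u^α ⟹ Z_N(w;s) = (s−α)^{−w}`
(`Re w > 0`, `Re s > Re α`); [Kurokawa–Tanaka, §1]: "let `f(x) = x^a` (`a ∈ ℂ`). Then
`Z_f(w,s) = (s−a)^{−w}`". [cite: KurokawaOchiai2013, §3 Lemma] [cite: KurokawaTanaka2017, §1 p. 591] -/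
theorem absoluteHurwitzZeta_single (α : ℂ) {w s : ℂ} (hw : 0 < w.re) (hs : α.re < s.re) :
    absoluteHurwitzZeta (fun u : ℝ => (u : ℂ) ^ α) w s = (s - α) ^ (-w) := by
  have h := absoluteHurwitzZeta_countFun (Finsupp.single α 1) hw (fun β hβ => by
    rw [((Finsupp.mem_support_single _ _ _).1 hβ).1]; exact hs)
  have hN : countFun (Finsupp.single α 1) = fun u : ℝ => (u : ℂ) ^ α := by
    funext u; rw [countFun_single]; simp
  rwa [hN, hurwitzSum_single, Int.cast_one, one_mul] at h

/-! ## §3. The analytic continuation in `w` and `ζ_N(s) = exp(∂_w Z_N(w;s)|_{w=0})` -/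

/-- Derivative in `w` of a finite sum `Σ_i k_i (s − γ_i)^{−w}` (off the exponents):
`∂_w (s−γ)^{−w} = −log(s−γ)(s−γ)^{−w}`. [cite: KurokawaOchiai2013, §3 ("`∂_w Z_N(w,s)|_{w=0} = −log(s−α)`")] -/
theorem hasDerivAt_sum_cpow {ι : Type*} (S : Finset ι) (k : ι → ℤ) (γ : ι → ℂ) {s : ℂ}
    (hs : ∀ i ∈ S, s ≠ γ i) (w : ℂ) :
    HasDerivAt (fun w => ∑ i ∈ S, (k i : ℂ) * (s - γ i) ^ (-w))
      (∑ i ∈ S, (k i : ℂ) * ((s - γ i) ^ (-w) * Complex.log (s - γ i) * (-1))) w := by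
  refine HasDerivAt.fun_sum fun i hi => ?_
  refine HasDerivAt.const_mul _ ?_
  exact (hasDerivAt_neg w).const_cpow (Or.inl (sub_ne_zero.2 (hs i hi)))

/-- `exp(∂_w (Σ_i k_i (s−γ_i)^{−w})|_{w=0}) = ∏_i (s−γ_i)^{−k_i}`: the computation
"`∂_w Z_N(w,s)|_{w=0} = −log(s−α)` and `ζ_N(s) = 1/(s−α)`" summed over a finite family.
[cite: KurokawaOchiai2013, §3] -/
theorem exp_deriv_sum_cpow {ι : Type*} (S : Finset ι) (k : ι → ℤ) (γ : ι → ℂ) {s : ℂ}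
    (hs : ∀ i ∈ S, s ≠ γ i) :
    Complex.exp (deriv (fun w : ℂ => ∑ i ∈ S, (k i : ℂ) * (s - γ i) ^ (-w)) 0) =
      ∏ i ∈ S, (s - γ i) ^ (-(k i)) := by
  rw [(hasDerivAt_sum_cpow S k γ hs 0).deriv, Complex.exp_sum]
  refine Finset.prod_congr rfl fun i hi => ?_
  rw [neg_zero, cpow_zero, one_mul, mul_neg_one,
    show (k i : ℂ) * -Complex.log (s - γ i) = ((-k i : ℤ) : ℂ) * Complex.log (s - γ i) by
      push_cast; ring,
    Complex.exp_int_mul, Complex.exp_log (sub_ne_zero.2 (hs i hi))]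

/-- `hurwitzSum` unfolded as a `Finset` sum over the support: `Σ_α m(α)(s−α)^{−w}`.
[cite: KurokawaOchiai2013, Thm A (1)] -/
theorem hurwitzSum_eq_sum (m : ℂ →₀ ℤ) (w s : ℂ) :
    hurwitzSum m w s = ∑ α ∈ m.support, (m α : ℂ) * (s - α) ^ (-w) := rfl

/-- `zetaProd` unfolded as a `Finset` product over the support: `∏_α (s−α)^{−m(α)}`.
[cite: KurokawaOchiai2013, Thm A (2)] -/
theorem zetaProd_eq_prod (m : ℂ →₀ ℤ) (s : ℂ) :
    zetaProd m s = ∏ α ∈ m.support, (s - α) ^ (-(m α)) := rfl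

/-- `w ↦ Σ_α m(α)(s−α)^{−w}` is differentiable, with the printed derivative. [cite: KurokawaOchiai2013, §3] -/
theorem hasDerivAt_hurwitzSum (m : ℂ →₀ ℤ) {s : ℂ} (hs : ∀ α ∈ m.support, s ≠ α) (w : ℂ) :
    HasDerivAt (fun w => hurwitzSum m w s)
      (∑ α ∈ m.support, (m α : ℂ) * ((s - α) ^ (-w) * Complex.log (s - α) * (-1))) w :=
  hasDerivAt_sum_cpow m.support m id hs w

/-- The closed form is an ENTIRE function of `w` (for `s` off the exponents): the analytic
continuation "to all `w ∈ ℂ`". [cite: KurokawaOchiai2013, §1–§2 ("analytic continuation to all `w ∈ ℂ`")] -/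
theorem differentiable_hurwitzSum (m : ℂ →₀ ℤ) {s : ℂ} (hs : ∀ α ∈ m.support, s ≠ α) :
    Differentiable ℂ fun w => hurwitzSum m w s :=
  fun w => (hasDerivAt_hurwitzSum m hs w).differentiableAt

/-- The closed form is analytic on all of `ℂ` in `w` (the continuation "in `w` to a region
containing `w = 0`"). [cite: KurokawaTanaka2017, §1 p. 591] [cite: KurokawaOchiai2013, §1] -/
theorem analyticOnNhd_hurwitzSum (m : ℂ →₀ ℤ) {s : ℂ} (hs : ∀ α ∈ m.support, s ≠ α) :
    AnalyticOnNhd ℂ (fun w => hurwitzSum m w s) univ :=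
  (differentiable_hurwitzSum m hs).differentiableOn.analyticOnNhd isOpen_univ

/-- **Uniqueness of the analytic continuation in `w`.**  If `G` is analytic on a connected open set
`U` meeting the half-plane `Re w > 0` and agrees there with `Z_N(w;s)`, then `G = Σ_α m(α)(s−α)^{−w}`
on all of `U` ("we assume that `Z_f(w,s)` has an analytic continuation in `w` to a region containing
`w = 0`"). [cite: KurokawaTanaka2017, §1 p. 591] [cite: KurokawaOchiai2013, §1 ("analytic continuation
to all `w ∈ ℂ` … via the usual method")] -/
theorem eqOn_hurwitzSum_of_continuation (m : ℂ →₀ ℤ) {s : ℂ} (hs : ReGt m s) {U : Set ℂ}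
    (hUo : IsOpen U) (hUc : IsPreconnected U) {G : ℂ → ℂ} (hG : AnalyticOnNhd ℂ G U)
    {z₀ : ℂ} (hz₀ : z₀ ∈ U) (hz₀' : 0 < z₀.re)
    (hGZ : ∀ w ∈ U, 0 < w.re → G w = absoluteHurwitzZeta (countFun m) w s) :
    EqOn G (fun w => hurwitzSum m w s) U := by
  refine hG.eqOn_of_preconnected_of_eventuallyEq
    ((analyticOnNhd_hurwitzSum m (ne_of_reGt hs)).mono (subset_univ U)) hUc hz₀ ?_
  have hmem : U ∩ {w : ℂ | 0 < w.re} ∈ 𝓝 z₀ :=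
    inter_mem (hUo.mem_nhds hz₀) ((isOpen_lt continuous_const Complex.continuous_re).mem_nhds hz₀')
  filter_upwards [hmem] with w hw
  rw [hGZ w hw.1 hw.2, absoluteHurwitzZeta_countFun m hw.2 hs]

/-- Hence `exp(∂_w G|_{w=0}) = ζ_N(s)` for every analytic continuation `G` of `Z_N(·;s)` to a
connected open `U ∋ 0`: the printed definition `ζ_N(s) = exp(∂_w Z_N(w;s)|_{w=0})` does not depend on
the continuation and equals `zetaReg m s`. [cite: KurokawaOchiai2013, §1 p. 75] [cite: KurokawaTanaka2017, §1 p. 591] -/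
theorem exp_deriv_eq_zetaReg_of_continuation (m : ℂ →₀ ℤ) {s : ℂ} (hs : ReGt m s) {U : Set ℂ}
    (hUo : IsOpen U) (hUc : IsPreconnected U) (h0 : (0 : ℂ) ∈ U) {G : ℂ → ℂ}
    (hG : AnalyticOnNhd ℂ G U) {z₀ : ℂ} (hz₀ : z₀ ∈ U) (hz₀' : 0 < z₀.re)
    (hGZ : ∀ w ∈ U, 0 < w.re → G w = absoluteHurwitzZeta (countFun m) w s) :
    Complex.exp (deriv G 0) = zetaReg m s := by
  have heq := eqOn_hurwitzSum_of_continuation m hs hUo hUc hG hz₀ hz₀' hGZ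
  rw [zetaReg, (heq.eventuallyEq_of_mem (hUo.mem_nhds h0)).deriv_eq]

/-- **Theorem A (2)** [Kurokawa–Ochiai]: `ζ_N(s) = ∏_α (s−α)^{−m(α)}` (for `s` off the exponents; in
particular on the half-plane of convergence). [cite: KurokawaOchiai2013, Thm A (2) and §3] -/
theorem zetaReg_eq_zetaProd (m : ℂ →₀ ℤ) {s : ℂ} (hs : ∀ α ∈ m.support, s ≠ α) :
    zetaReg m s = zetaProd m s :=
  exp_deriv_sum_cpow m.support m id hs

/-- Theorem A (2) on the half-plane of convergence `Re s > Re α`. [cite: KurokawaOchiai2013, Thm A (2)] -/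
theorem zetaReg_eq_zetaProd_of_reGt (m : ℂ →₀ ℤ) {s : ℂ} (hs : ReGt m s) :
    zetaReg m s = zetaProd m s :=
  zetaReg_eq_zetaProd m (ne_of_reGt hs)

/-- The monomial case: `ζ_{u^α}(s) = 1/(s−α)`. [cite: KurokawaOchiai2013, §3 Lemma]
[cite: KurokawaTanaka2017, §1 p. 591 ("`ζ_f(s) = 1/(s−a)`")] -/
theorem zetaReg_single (α : ℂ) {s : ℂ} (hs : s ≠ α) :
    zetaReg (Finsupp.single α 1) s = (s - α)⁻¹ := by
  rw [zetaReg_eq_zetaProd _ (fun β hβ => by rwa [((Finsupp.mem_support_single _ _ _).1 hβ).1]),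
    zetaProd, Finsupp.prod_single_index] <;> simp

/-! ## §4. Theorem B: direct sum and Kurokawa tensor product -/

/-- `N ↦ N(u)` is additive in the multiplicity function. [cite: KurokawaOchiai2013, Thm B (1)] -/
theorem countFun_add (m₁ m₂ : ℂ →₀ ℤ) (u : ℝ) :
    countFun (m₁ + m₂) u = countFun m₁ u + countFun m₂ u := by
  unfold countFun
  exact Finsupp.sum_add_index' (fun _ => by simp) (fun _ _ _ => by push_cast; ring)

/-- `hurwitzSum` is additive in the multiplicity function. [cite: KurokawaOchiai2013, Thm B (1)] -/
theorem hurwitzSum_add (m₁ m₂ : ℂ →₀ ℤ) (w s : ℂ) :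
    hurwitzSum (m₁ + m₂) w s = hurwitzSum m₁ w s + hurwitzSum m₂ w s := by
  unfold hurwitzSum
  exact Finsupp.sum_add_index' (fun _ => by simp) (fun _ _ _ => by push_cast; ring)

/-- `m ↦ N_m(u)` as an additive homomorphism. [folklore] -/
def countFunHom (u : ℝ) : (ℂ →₀ ℤ) →+ ℂ where
  toFun m := countFun m u
  map_zero' := by simp [countFun]
  map_add' m₁ m₂ := countFun_add m₁ m₂ u

/-- `countFunHom u m = N_m(u)`. [cite: KurokawaOchiai2013, Thm B (1)] -/
@[simp] theorem countFunHom_apply (u : ℝ) (m : ℂ →₀ ℤ) : countFunHom u m = countFun m u := rfl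

/-- `m ↦ Σ_α m(α)(s−α)^{−w}` as an additive homomorphism. [folklore] -/
def hurwitzSumHom (w s : ℂ) : (ℂ →₀ ℤ) →+ ℂ where
  toFun m := hurwitzSum m w s
  map_zero' := by simp [hurwitzSum]
  map_add' m₁ m₂ := hurwitzSum_add m₁ m₂ w s

/-- `hurwitzSumHom w s m = Σ_α m(α)(s−α)^{−w}`. [cite: KurokawaOchiai2013, Thm B (1)] -/
@[simp] theorem hurwitzSumHom_apply (w s : ℂ) (m : ℂ →₀ ℤ) :
    hurwitzSumHom w s m = hurwitzSum m w s := rfl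

/-- **Theorem B (1)**, integral level: `Z_{N₁⊕N₂}(w;s) = Z_{N₁}(w;s) + Z_{N₂}(w;s)` whenever both
integrals converge. [cite: KurokawaOchiai2013, Thm B (1) and §4] -/
theorem absoluteHurwitzZeta_add (N₁ N₂ : ℝ → ℂ) (w s : ℂ)
    (h₁ : IntegrableOn (fun u : ℝ => N₁ u * (u : ℂ) ^ (-s - 1) * ((Real.log u : ℝ) : ℂ) ^ (w - 1))
      (Ioi 1))
    (h₂ : IntegrableOn (fun u : ℝ => N₂ u * (u : ℂ) ^ (-s - 1) * ((Real.log u : ℝ) : ℂ) ^ (w - 1))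
      (Ioi 1)) :
    absoluteHurwitzZeta (fun u => N₁ u + N₂ u) w s =
      absoluteHurwitzZeta N₁ w s + absoluteHurwitzZeta N₂ w s := by
  unfold absoluteHurwitzZeta
  rw [← mul_add, ← integral_add h₁ h₂]
  congr 1
  refine setIntegral_congr_fun measurableSet_Ioi (fun u _ => ?_)
  ring

/-- **Theorem B (1)**: `ζ_{N₁⊕N₂}(s) = ζ_{N₁}(s) ζ_{N₂}(s)` (for `s` off the exponents of both).
[cite: KurokawaOchiai2013, Thm B (1)] -/
theorem zetaReg_add (m₁ m₂ : ℂ →₀ ℤ) {s : ℂ} (hs₁ : ∀ α ∈ m₁.support, s ≠ α)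
    (hs₂ : ∀ α ∈ m₂.support, s ≠ α) :
    zetaReg (m₁ + m₂) s = zetaReg m₁ s * zetaReg m₂ s := by
  rw [zetaReg, zetaReg, zetaReg, ← Complex.exp_add]
  congr 1
  have h : (fun w => hurwitzSum (m₁ + m₂) w s) =
      fun w => hurwitzSum m₁ w s + hurwitzSum m₂ w s := funext fun w => hurwitzSum_add m₁ m₂ w s
  rw [h, deriv_fun_add (differentiable_hurwitzSum m₁ hs₁ 0) (differentiable_hurwitzSum m₂ hs₂ 0)]

/-- Theorem B (1) for the products: `∏(s−α)^{−(m₁+m₂)(α)} = ∏(s−α)^{−m₁(α)} ∏(s−α)^{−m₂(α)}` off the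
exponents. [cite: KurokawaOchiai2013, Thm B (1)] -/
theorem zetaProd_add (m₁ m₂ : ℂ →₀ ℤ) {s : ℂ} (hs₁ : ∀ α ∈ m₁.support, s ≠ α)
    (hs₂ : ∀ α ∈ m₂.support, s ≠ α) :
    zetaProd (m₁ + m₂) s = zetaProd m₁ s * zetaProd m₂ s := by
  classical
  unfold zetaProd
  refine Finsupp.prod_add_index (fun _ _ => by simp) (fun α hα b₁ b₂ => ?_)
  have hα' : s - α ≠ 0 := by
    rcases Finset.mem_union.1 hα with h | h
    · exact sub_ne_zero.2 (hs₁ α h)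
    · exact sub_ne_zero.2 (hs₂ α h)
  rw [neg_add, zpow_add₀ hα']

/-- The Kurokawa tensor product of two finite sums: `(N₁⊗N₂)(u) = N₁(u)N₂(u)`, i.e. the multiplicity
function `γ ↦ Σ_{α₁+α₂=γ} m₁(α₁)m₂(α₂)`. [cite: KurokawaOchiai2013, Thm B (2)] -/
def tensor (m₁ m₂ : ℂ →₀ ℤ) : ℂ →₀ ℤ :=
  m₁.sum fun α₁ k₁ => m₂.sum fun α₂ k₂ => Finsupp.single (α₁ + α₂) (k₁ * k₂)

/-- `(N₁⊗N₂)(u) = N₁(u) N₂(u)` for `u > 0`. [cite: KurokawaOchiai2013, Thm B (2) and §4] -/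
theorem countFun_tensor (m₁ m₂ : ℂ →₀ ℤ) {u : ℝ} (hu : 0 < u) :
    countFun (tensor m₁ m₂) u = countFun m₁ u * countFun m₂ u := by
  have hu0 : (u : ℂ) ≠ 0 := ofReal_ne_zero.2 hu.ne'
  rw [← countFunHom_apply, tensor, map_finsuppSum]
  simp_rw [map_finsuppSum, countFunHom_apply, countFun_single]
  simp only [countFun, Finsupp.sum]
  rw [Finset.sum_mul]
  simp_rw [Finset.mul_sum]
  refine Finset.sum_congr rfl fun α₁ _ => Finset.sum_congr rfl fun α₂ _ => ?_
  rw [cpow_add _ _ hu0]; push_cast; ring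

/-- **Theorem B (2)**, first display: `Z_{N₁⊗N₂}(w;s) = Σ_{α₁,α₂} m₁(α₁)m₂(α₂)(s−(α₁+α₂))^{−w}`
(the closed form; unconditional). [cite: KurokawaOchiai2013, Thm B (2) and §4] -/
theorem hurwitzSum_tensor (m₁ m₂ : ℂ →₀ ℤ) (w s : ℂ) :
    hurwitzSum (tensor m₁ m₂) w s =
      ∑ α₁ ∈ m₁.support, ∑ α₂ ∈ m₂.support,
        ((m₁ α₁ * m₂ α₂ : ℤ) : ℂ) * (s - (α₁ + α₂)) ^ (-w) := by
  rw [← hurwitzSumHom_apply, tensor, map_finsuppSum]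
  simp_rw [map_finsuppSum, hurwitzSumHom_apply, hurwitzSum_single]
  rfl

/-- **Theorem B (2)**, second display: `ζ_{N₁⊗N₂}(s) = ∏_{α₁,α₂}(s−(α₁+α₂))^{−m₁(α₁)m₂(α₂)}` for `s`
off the sums of exponents. [cite: KurokawaOchiai2013, Thm B (2) and §4] -/
theorem zetaReg_tensor (m₁ m₂ : ℂ →₀ ℤ) {s : ℂ}
    (hs : ∀ α₁ ∈ m₁.support, ∀ α₂ ∈ m₂.support, s ≠ α₁ + α₂) :
    zetaReg (tensor m₁ m₂) s =
      ∏ α₁ ∈ m₁.support, ∏ α₂ ∈ m₂.support, (s - (α₁ + α₂)) ^ (-(m₁ α₁ * m₂ α₂)) := by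
  have h : (fun w => hurwitzSum (tensor m₁ m₂) w s) = fun w =>
      ∑ p ∈ m₁.support ×ˢ m₂.support, ((m₁ p.1 * m₂ p.2 : ℤ) : ℂ) * (s - (p.1 + p.2)) ^ (-w) := by
    funext w
    rw [hurwitzSum_tensor, Finset.sum_product]
  rw [zetaReg, h, exp_deriv_sum_cpow (m₁.support ×ˢ m₂.support) (fun p => m₁ p.1 * m₂ p.2)
    (fun p => p.1 + p.2) (fun p hp => hs p.1 (Finset.mem_product.1 hp).1 p.2
      (Finset.mem_product.1 hp).2), Finset.prod_product]

/-! ## §5. Examples 1–2 of [KurokawaOchiai2013] -/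

/-- Example 1: `X = Spec 𝔽₁`, `N_X(u) = 1`: `Z_X(w;s) = s^{−w}`. [cite: KurokawaOchiai2013, §1 Example 1] -/
theorem hurwitzSum_specF1 (w s : ℂ) : hurwitzSum (Finsupp.single 0 1) w s = s ^ (-w) := by
  rw [hurwitzSum_single]; simp

/-- Example 1: `ζ_{Spec 𝔽₁}(s) = 1/s`. [cite: KurokawaOchiai2013, §1 Example 1] -/
theorem zetaReg_specF1 {s : ℂ} (hs : s ≠ 0) : zetaReg (Finsupp.single 0 1) s = s⁻¹ := by
  rw [zetaReg_single 0 hs, sub_zero]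

/-- Example 2: `X = SL(2)`, `N_X(u) = u³ − u`, i.e. the multiplicity function `δ_3 − δ_1`.
[cite: KurokawaOchiai2013, §1 Example 2] -/
def multSL2 : ℂ →₀ ℤ := Finsupp.single 3 1 + Finsupp.single 1 (-1)

/-- Example 2: `N_{SL(2)}(u) = u³ − u`. [cite: KurokawaOchiai2013, §1 Example 2] -/
theorem countFun_multSL2 (u : ℝ) : countFun multSL2 u = (u : ℂ) ^ (3 : ℕ) - u := by
  rw [multSL2, countFun_add, countFun_single, countFun_single, ← cpow_natCast, cpow_one]
  push_cast
  ring

/-- Example 2: `Z_{SL(2)}(w;s) = (s−3)^{−w} − (s−1)^{−w}`. [cite: KurokawaOchiai2013, §1 Example 2] -/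
theorem hurwitzSum_multSL2 (w s : ℂ) :
    hurwitzSum multSL2 w s = (s - 3) ^ (-w) - (s - 1) ^ (-w) := by
  rw [multSL2, hurwitzSum_add, hurwitzSum_single, hurwitzSum_single]
  push_cast
  ring

/-- Example 2: `ζ_{SL(2)}(s) = (s−1)/(s−3)`. [cite: KurokawaOchiai2013, §1 Example 2] -/
theorem zetaReg_multSL2 {s : ℂ} (h3 : s ≠ 3) (h1 : s ≠ 1) : zetaReg multSL2 s = (s - 1) / (s - 3) := by
  have hs3 : ∀ α ∈ (Finsupp.single (3 : ℂ) (1 : ℤ)).support, s ≠ α := fun β hβ => by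
    rw [((Finsupp.mem_support_single _ _ _).1 hβ).1]; exact h3
  have hs1 : ∀ α ∈ (Finsupp.single (1 : ℂ) (-1 : ℤ)).support, s ≠ α := fun β hβ => by
    rw [((Finsupp.mem_support_single _ _ _).1 hβ).1]; exact h1
  rw [multSL2, zetaReg_add _ _ hs3 hs1, zetaReg_eq_zetaProd _ hs3, zetaReg_eq_zetaProd _ hs1, zetaProd,
    zetaProd, Finsupp.prod_single_index (by simp), Finsupp.prod_single_index (by simp), neg_neg,
    zpow_one, zpow_neg, zpow_one, div_eq_mul_inv, mul_comm]

end AbsoluteZeta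

end Literature.NumberTheory.F1Geometry
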